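import Mathlib
import Summits.MatrixMultiplication.MatrixMultiplication.Theorems.SnSubsetDichotomyHyperoctahedralThresholdStubPatternTwin
import Summits.MatrixMultiplication.MatrixMultiplication.Theorems.SnSubsetDichotomyHyperoctahedralThresholdRotationIdentity

/-!
# The bulk twins ℓ² reduction, LOCAL form: a counted clean twin-walk family inside a rotation-closed family of pre-pairs
(crux `SnSubsetDichotomy.HyperoctahedralThreshold`, stmt-MatrixMultiplication-10883; siege seat k18, variation "twins ℓ² argument";
`--supports` helper; local companion of `…TwinsEll2Bulk` (p116155), for the altline `stub_oneScaleDichotomy` branch (B))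

Vocabulary as in the companions: involutions `μ c` of `Fin n`, `x · z := z.foldl (fun v c => μ c v) x`; `P'` a ROTATION-CLOSED finset of twin
pre-pairs `(z, x, y)` of length `k + 2` (`hP'`, `hrot` as in `…TwinDefectsLocal`) — e.g. the pre-pairs whose trajectories avoid the dense
vertices `D` (`…TwinAvoidFamily`, p116777).  Why local: a dense near-Cayley piece (inside the forbidden set or not) carries almost all global
pre-pairs and inflates the global point-degree; choosing `P'` = pre-pairs avoiding it removes it from EVERY term below without surgery.

`stub_twinsEll2BulkLocal`: if the pre-pairs of `P'` based at any vertex (as first OR as second point) number `≤ Dp` and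
      `#SELF₁(P') + #SELF₂(P') + #CROSS(P') + 2(k+2)·(2(k+2)·Dp)·G < |P'|`
(incidence sets inside `P'` as in `…TwinsEll2Local`), then the GOOD members of `P'`, read as walk data `(t ↦ z[t], t ↦ x·z.take t, t ↦ y·z.take t)`,
form a finset `W` of clean closed rung-walks in the clause format of branch (B) of `stub_oneScaleDichotomy`, of point-degree `≤ D := 2(k+2)·Dp`,
with `2(k+2)·D·G < |W|`.  Proof as in `…TwinsEll2Bulk`, the degree bound now rotating INSIDE `P'` (a member through `v` at time `i` rotates to a
member based at `v`).  With `selfIncLocal_*` / `crossIncLocal_le` (p116667) the three incidence counts are `≤ (k+2)·(Ret₁ + Ret₂ + Ξ)(P')`.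
Pure finite combinatorics; hypothesis `μ c * μ c = 1`; no definitions.
-/

set_option linter.dupNamespace false

namespace Summit.MatrixMultiplication.MatrixMultiplication.Theorems.HyperoctahedralThreshold

namespace TwinsEll2

open Finset Rotation

variable {n : ℕ}

/-- (Private copy of `TwinsEll2.walkData_clauses` of `…TwinsEll2Bulk`, p116155, not yet built on the farm.)  The explicit clean-walk data of a good twin pre-pair `(z; x, y)` of length `k + 2`: colours `t ↦ z[t]`, sides
`t ↦ x · z.take t` and `t ↦ y · z.take t`.  (Total in `z` via `List.getD`.) -/
private theorem walkData_clauses' (μ : Fin 3 → Equiv.Perm (Fin n)) {k : ℕ} {z : List (Fin 3)} (hzl : z.length = k + 2)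
    (hchain : List.IsChain (· ≠ ·) (z ++ z)) {x y : Fin n}
    (hx : z.foldl (fun v c => μ c v) x = x) (hy : z.foldl (fun v c => μ c v) y = y)
    (hsx : ∀ s < z.length, ∀ t < z.length,
      (z.take s).foldl (fun v c => μ c v) x = (z.take t).foldl (fun v c => μ c v) x → s = t)
    (hsy : ∀ s < z.length, ∀ t < z.length,
      (z.take s).foldl (fun v c => μ c v) y = (z.take t).foldl (fun v c => μ c v) y → s = t)
    (hcross : ∀ s < z.length, ∀ t < z.length,
      (z.take s).foldl (fun v c => μ c v) x ≠ (z.take t).foldl (fun v c => μ c v) y) :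
    let w : (Fin (k + 2) → Fin 3) × (Fin (k + 2) → Fin n) × (Fin (k + 2) → Fin n) :=
      (fun i => z.getD i 0, fun i => (z.take i).foldl (fun v c => μ c v) x, fun i => (z.take i).foldl (fun v c => μ c v) y)
    (∀ i, w.2.1 i ≠ w.2.2 i) ∧
      (∀ i, (μ (w.1 i) (w.2.1 i) = w.2.1 (i + 1) ∧ μ (w.1 i) (w.2.2 i) = w.2.2 (i + 1)) ∨
        (μ (w.1 i) (w.2.1 i) = w.2.2 (i + 1) ∧ μ (w.1 i) (w.2.2 i) = w.2.1 (i + 1))) ∧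
      (∀ i, w.1 i ≠ w.1 (i + 1)) ∧
      (∀ i j, (w.2.1 i = w.2.1 j ∧ w.2.2 i = w.2.2 j) ∨ (w.2.1 i = w.2.2 j ∧ w.2.2 i = w.2.1 j) ∨
        (w.2.1 i ≠ w.2.1 j ∧ w.2.1 i ≠ w.2.2 j ∧ w.2.2 i ≠ w.2.1 j ∧ w.2.2 i ≠ w.2.2 j)) := by
  intro w
  have hlt : ∀ i : Fin (k + 2), (i : ℕ) < z.length := fun i => i.isLt.trans_eq hzl.symm
  have hval : ∀ i : Fin (k + 2), ((i + 1 : Fin (k + 2)) : ℕ) = ((i : ℕ) + 1) % z.length := fun i => by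
    rw [PatternTwin.val_add_one, hzl]
  have hcol : ∀ i : Fin (k + 2), w.1 i = z[(i : ℕ)]'(hlt i) := fun i => List.getD_eq_getElem z 0 (hlt i)
  refine ⟨?_, ?_, ?_, ?_⟩
  · intro i
    exact hcross i (hlt i) i (hlt i)
  · intro i
    refine Or.inl ⟨?_, ?_⟩
    · show μ (w.1 i) ((z.take i).foldl (fun v c => μ c v) x) =
        (z.take ((i + 1 : Fin (k + 2)) : ℕ)).foldl (fun v c => μ c v) x
      rw [hcol i, hval i]
      exact GoodTwin.foldl_take_step μ z x hx i (hlt i)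
    · show μ (w.1 i) ((z.take i).foldl (fun v c => μ c v) y) =
        (z.take ((i + 1 : Fin (k + 2)) : ℕ)).foldl (fun v c => μ c v) y
      rw [hcol i, hval i]
      exact GoodTwin.foldl_take_step μ z y hy i (hlt i)
  · intro i
    rw [hcol i, hcol (i + 1)]
    exact GoodTwin.cyclic_ne hchain i _ (hlt i) (hlt (i + 1)) (hval i)
  · intro i j
    by_cases hij : i = j
    · subst hij
      exact Or.inl ⟨rfl, rfl⟩
    · have hij' : (i : ℕ) ≠ (j : ℕ) := fun h => hij (Fin.ext h)
      refine Or.inr (Or.inr ⟨fun h => hij' (hsx i (hlt i) j (hlt j) h), hcross i (hlt i) j (hlt j),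
        fun h => hcross j (hlt j) i (hlt i) h.symm, fun h => hij' (hsy i (hlt i) j (hlt j) h)⟩)


/-- **`stub_twinsEll2BulkLocal` — the bulk twins ℓ² reduction inside a rotation-closed family** (registered `--supports` sub-goal of crux
stmt-MatrixMultiplication-10883). -/
theorem stub_twinsEll2BulkLocal : ∀ (n k G Dp : ℕ) (μ : Fin 3 → Equiv.Perm (Fin n)) (P' : Finset (List (Fin 3) × Fin n × Fin n)), (∀ c, μ c * μ c = 1) → (∀ t ∈ P', t.1.length = k + 2 ∧ List.IsChain (· ≠ ·) (t.1 ++ t.1) ∧ t.1.foldl (fun v c => μ c v) t.2.1 = t.2.1 ∧ t.1.foldl (fun v c => μ c v) t.2.2 = t.2.2 ∧ t.2.1 ≠ t.2.2) → (∀ t ∈ P', ∀ s < k + 2, ((t.1.rotate s, (t.1.take s).foldl (fun v c => μ c v) t.2.1, (t.1.take s).foldl (fun v c => μ c v) t.2.2) : List (Fin 3) × Fin n × Fin n) ∈ P') → (∀ v : Fin n, (P'.filter (fun t => t.2.1 = v)).card ≤ Dp ∧ (P'.filter (fun t => t.2.2 = v)).card ≤ Dp) → ((P' ×ˢ Finset.range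 (k + 2) ×ˢ Finset.range (k + 2)).filter (fun a => a.2.1 < a.2.2 ∧ (a.1.1.take a.2.1).foldl (fun v c => μ c v) a.1.2.1 = (a.1.1.take a.2.2).foldl (fun v c => μ c v) a.1.2.1)).card + ((P' ×ˢ Finset.range (k + 2) ×ˢ Finset.range (k + 2)).filter (fun a => a.2.1 < a.2.2 ∧ (a.1.1.take a.2.1).foldl (fun v c => μ c v) a.1.2.2 = (a.1.1.take a.2.2).foldl (fun v c => μ c v) a.1.2.2)).card + ((P' ×ˢ Finset.range (k + 2) ×ˢ Finset.range (k + 2)).filter (fun a => (a.1.1.take a.2.1).foldl (fun v c => μ c v) a.1.2.1 = (a.1.1.take a.2.2).foldl (fun v c => μ c v) a.1.2.2)).card + 2 * (k + 2) * (2 * (k + 2) * Dp) * G < P'.card → ∃ (W : Finset ((Fin (k + 2) → Fin 3) × (Fin (k + 2) → Fin n) × (Fin (k + 2) → Fin n))) (D : ℕ), (∀ w ∈ W, (∀ i, w.2.1 i ≠ w.2.2 i) ∧ (∀ i, (μ (w.1 i) (w.2.1 i) = w.2.1 (i + 1) ∧ μ (w.1 i) (w.2.2 i) = w.2.2 (i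 + 1)) ∨ (μ (w.1 i) (w.2.1 i) = w.2.2 (i + 1) ∧ μ (w.1 i) (w.2.2 i) = w.2.1 (i + 1))) ∧ (∀ i, w.1 i ≠ w.1 (i + 1)) ∧ (∀ i j, (w.2.1 i = w.2.1 j ∧ w.2.2 i = w.2.2 j) ∨ (w.2.1 i = w.2.2 j ∧ w.2.2 i = w.2.1 j) ∨ (w.2.1 i ≠ w.2.1 j ∧ w.2.1 i ≠ w.2.2 j ∧ w.2.2 i ≠ w.2.1 j ∧ w.2.2 i ≠ w.2.2 j))) ∧ (∀ v : Fin n, (W.filter (fun w => ∃ i, w.2.1 i = v ∨ w.2.2 i = v)).card ≤ D) ∧ 2 * (k + 2) * D * G < W.card := by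
  intro n k G Dp μ P' hμ hP' hrot hDp hcount
  classical
  set BSx := P'.filter (fun t => ∃ s < k + 2, ∃ s' < k + 2, s < s' ∧
    (t.1.take s).foldl (fun v c => μ c v) t.2.1 = (t.1.take s').foldl (fun v c => μ c v) t.2.1) with hBSx
  set BSy := P'.filter (fun t => ∃ s < k + 2, ∃ s' < k + 2, s < s' ∧
    (t.1.take s).foldl (fun v c => μ c v) t.2.2 = (t.1.take s').foldl (fun v c => μ c v) t.2.2) with hBSy
  set BC := P'.filter (fun t => ∃ s < k + 2, ∃ s' < k + 2,
    (t.1.take s).foldl (fun v c => μ c v) t.2.1 = (t.1.take s').foldl (fun v c => μ c v) t.2.2) with hBC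
  set ISx := (P' ×ˢ range (k + 2) ×ˢ range (k + 2)).filter (fun a => a.2.1 < a.2.2 ∧
    (a.1.1.take a.2.1).foldl (fun v c => μ c v) a.1.2.1 = (a.1.1.take a.2.2).foldl (fun v c => μ c v) a.1.2.1) with hISx
  set ISy := (P' ×ˢ range (k + 2) ×ˢ range (k + 2)).filter (fun a => a.2.1 < a.2.2 ∧
    (a.1.1.take a.2.1).foldl (fun v c => μ c v) a.1.2.2 = (a.1.1.take a.2.2).foldl (fun v c => μ c v) a.1.2.2) with hISy
  set IC := (P' ×ˢ range (k + 2) ×ˢ range (k + 2)).filter (fun a =>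
    (a.1.1.take a.2.1).foldl (fun v c => μ c v) a.1.2.1 = (a.1.1.take a.2.2).foldl (fun v c => μ c v) a.1.2.2) with hIC
  set Good := P' \ (BSx ∪ BSy ∪ BC) with hGood
  -- (1) bad members are covered by incidences
  have h1 : BSx.card ≤ ISx.card := by
    refine card_le_card_of_surjOn (fun a => a.1) ?_
    intro t h
    rw [mem_coe, hBSx, mem_filter] at h
    obtain ⟨ht, s, hs, s', hs', hss', hcoin⟩ := h
    refine ⟨(t, s, s'), ?_, rfl⟩
    rw [mem_coe, hISx, mem_filter]
    simp only [mem_product, mem_range]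
    exact ⟨⟨ht, hs, hs'⟩, hss', hcoin⟩
  have h2 : BSy.card ≤ ISy.card := by
    refine card_le_card_of_surjOn (fun a => a.1) ?_
    intro t h
    rw [mem_coe, hBSy, mem_filter] at h
    obtain ⟨ht, s, hs, s', hs', hss', hcoin⟩ := h
    refine ⟨(t, s, s'), ?_, rfl⟩
    rw [mem_coe, hISy, mem_filter]
    simp only [mem_product, mem_range]
    exact ⟨⟨ht, hs, hs'⟩, hss', hcoin⟩
  have h3 : BC.card ≤ IC.card := by
    refine card_le_card_of_surjOn (fun a => a.1) ?_
    intro t h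
    rw [mem_coe, hBC, mem_filter] at h
    obtain ⟨ht, s, hs, s', hs', hcoin⟩ := h
    refine ⟨(t, s, s'), ?_, rfl⟩
    rw [mem_coe, hIC, mem_filter]
    simp only [mem_product, mem_range]
    exact ⟨⟨ht, hs, hs'⟩, hcoin⟩
  -- (2) many good members
  have hGoodCard : 2 * (k + 2) * (2 * (k + 2) * Dp) * G < Good.card := by
    have hc : ISx.card + ISy.card + IC.card + 2 * (k + 2) * (2 * (k + 2) * Dp) * G < P'.card := hcount
    have hle : P'.card ≤ Good.card + (BSx ∪ BSy ∪ BC).card := card_le_card_sdiff_add_card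
    have hU : (BSx ∪ BSy ∪ BC).card ≤ BSx.card + BSy.card + BC.card :=
      (card_union_le _ _).trans (Nat.add_le_add_right (card_union_le _ _) _)
    have hB := Nat.add_le_add (Nat.add_le_add h1 h2) h3
    omega
  -- (3) goodness, unpacked
  have goodP : ∀ {z : List (Fin 3)} {x y : Fin n}, ((z, x, y) : List (Fin 3) × Fin n × Fin n) ∈ Good →
      ((z, x, y) : List (Fin 3) × Fin n × Fin n) ∈ P' ∧ (z.length = k + 2 ∧ List.IsChain (· ≠ ·) (z ++ z)) ∧
        z.foldl (fun v c => μ c v) x = x ∧ z.foldl (fun v c => μ c v) y = y ∧ x ≠ y := by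
    intro z x y hg
    rw [hGood, mem_sdiff] at hg
    obtain ⟨hzl, hchain, hx, hy, hxy⟩ := hP' _ hg.1
    exact ⟨hg.1, ⟨hzl, hchain⟩, hx, hy, hxy⟩
  have goodX : ∀ {z : List (Fin 3)} {x y : Fin n}, ((z, x, y) : List (Fin 3) × Fin n × Fin n) ∈ Good →
      ∀ s < z.length, ∀ t < z.length,
        (z.take s).foldl (fun v c => μ c v) x = (z.take t).foldl (fun v c => μ c v) x → s = t := by
    intro z x y hg s hs t ht h
    have hzl := (goodP hg).2.1.1
    have hPm := (goodP hg).1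
    have hg' := hg
    rw [hGood, mem_sdiff] at hg'
    have hnot := hg'.2
    simp only [mem_union, not_or] at hnot
    by_contra hst
    rcases Nat.lt_or_gt_of_ne hst with hlt | hlt
    · exact hnot.1.1 (by rw [hBSx, mem_filter]; exact ⟨hPm, s, by omega, t, by omega, hlt, h⟩)
    · exact hnot.1.1 (by rw [hBSx, mem_filter]; exact ⟨hPm, t, by omega, s, by omega, hlt, h.symm⟩)
  have goodY : ∀ {z : List (Fin 3)} {x y : Fin n}, ((z, x, y) : List (Fin 3) × Fin n × Fin n) ∈ Good →
      ∀ s < z.length, ∀ t < z.length,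
        (z.take s).foldl (fun v c => μ c v) y = (z.take t).foldl (fun v c => μ c v) y → s = t := by
    intro z x y hg s hs t ht h
    have hzl := (goodP hg).2.1.1
    have hPm := (goodP hg).1
    have hg' := hg
    rw [hGood, mem_sdiff] at hg'
    have hnot := hg'.2
    simp only [mem_union, not_or] at hnot
    by_contra hst
    rcases Nat.lt_or_gt_of_ne hst with hlt | hlt
    · exact hnot.1.2 (by rw [hBSy, mem_filter]; exact ⟨hPm, s, by omega, t, by omega, hlt, h⟩)
    · exact hnot.1.2 (by rw [hBSy, mem_filter]; exact ⟨hPm, t, by omega, s, by omega, hlt, h.symm⟩)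
  have goodC : ∀ {z : List (Fin 3)} {x y : Fin n}, ((z, x, y) : List (Fin 3) × Fin n × Fin n) ∈ Good →
      ∀ s < z.length, ∀ t < z.length,
        (z.take s).foldl (fun v c => μ c v) x ≠ (z.take t).foldl (fun v c => μ c v) y := by
    intro z x y hg s hs t ht h
    have hzl := (goodP hg).2.1.1
    have hPm := (goodP hg).1
    have hg' := hg
    rw [hGood, mem_sdiff] at hg'
    have hnot := hg'.2
    simp only [mem_union, not_or] at hnot
    exact hnot.2 (by rw [hBC, mem_filter]; exact ⟨hPm, s, by omega, t, by omega, h⟩)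
  -- (4) the walk data map and its injectivity on `Good`
  let T : List (Fin 3) × Fin n × Fin n → (Fin (k + 2) → Fin 3) × (Fin (k + 2) → Fin n) × (Fin (k + 2) → Fin n) :=
    fun t => (fun i => t.1.getD i 0, fun i => (t.1.take i).foldl (fun v c => μ c v) t.2.1,
      fun i => (t.1.take i).foldl (fun v c => μ c v) t.2.2)
  have hTinj : Set.InjOn T ↑Good := by
    rintro ⟨z₁, x₁, y₁⟩ h₁ ⟨z₂, x₂, y₂⟩ h₂ heq
    have hl₁ := (goodP (mem_coe.1 h₁)).2.1.1
    have hl₂ := (goodP (mem_coe.1 h₂)).2.1.1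
    simp only [T, Prod.mk.injEq] at heq
    obtain ⟨hz, hx, hy⟩ := heq
    have hx0 := congrFun hx 0
    have hy0 := congrFun hy 0
    simp only [Fin.val_zero, List.take_zero, List.foldl_nil] at hx0 hy0
    have hz' : z₁ = z₂ := by
      refine List.ext_getElem (by rw [hl₁, hl₂]) fun i hi₁ hi₂ => ?_
      have := congrFun hz ⟨i, by omega⟩
      simp only at this
      rwa [List.getD_eq_getElem z₁ 0 hi₁, List.getD_eq_getElem z₂ 0 hi₂] at this
    rw [hz', hx0, hy0]
  refine ⟨Good.image T, 2 * (k + 2) * Dp, ?_, ?_, ?_⟩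
  · -- clauses
    intro w hw
    obtain ⟨⟨z, x, y⟩, hg, rfl⟩ := mem_image.1 hw
    obtain ⟨-, ⟨hzl, hchain⟩, hx, hy, -⟩ := goodP hg
    exact walkData_clauses' μ hzl hchain hx hy (goodX hg) (goodY hg) (goodC hg)
  · -- degree: rotate inside `P'`
    intro v
    rw [filter_image]
    refine card_image_le.trans ?_
    -- incidences `(t, i)` of members of `P'` through `v`, split by side
    set Ax := (P' ×ˢ range (k + 2)).filter (fun a => (a.1.1.take a.2).foldl (fun v c => μ c v) a.1.2.1 = v) with hAx
    set Ay := (P' ×ˢ range (k + 2)).filter (fun a => (a.1.1.take a.2).foldl (fun v c => μ c v) a.1.2.2 = v) with hAy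
    have hcover : (Good.filter (fun t => ∃ i : Fin (k + 2), T t |>.2.1 i = v ∨ (T t).2.2 i = v)).card ≤ (Ax ∪ Ay).card := by
      refine card_le_card_of_surjOn (fun a => a.1) ?_
      rintro ⟨z, x, y⟩ h
      rw [mem_coe, mem_filter] at h
      obtain ⟨hg, i, hi⟩ := h
      have hPm := (goodP hg).1
      refine ⟨((z, x, y), (i : ℕ)), ?_, rfl⟩
      rw [mem_coe, mem_union, hAx, hAy, mem_filter, mem_filter]
      simp only [mem_product, mem_range]
      rcases hi with hi | hi
      · exact Or.inl ⟨⟨hPm, i.isLt⟩, hi⟩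
      · exact Or.inr ⟨⟨hPm, i.isLt⟩, hi⟩
    have hxside : Ax.card ≤ (k + 2) * Dp := by
      have hcp : (range (k + 2) ×ˢ P'.filter (fun t => t.2.1 = v)).card ≤ (k + 2) * Dp := by
        rw [card_product, card_range]; exact Nat.mul_le_mul_left _ (hDp v).1
      refine le_trans ?_ hcp
      refine card_le_card_of_injOn (fun a => (a.2, (a.1.1.rotate a.2, (a.1.1.take a.2).foldl (fun v c => μ c v) a.1.2.1,
        (a.1.1.take a.2).foldl (fun v c => μ c v) a.1.2.2))) ?_ ?_
      · rintro ⟨⟨z, x, y⟩, i⟩ h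
        rw [mem_coe, hAx, mem_filter] at h
        obtain ⟨hmem, hv⟩ := h
        simp only [mem_product, mem_range] at hmem
        obtain ⟨hzP, hi⟩ := hmem
        dsimp only at hv hi
        simp only
        rw [mem_coe, mem_product, mem_filter]
        exact ⟨mem_range.2 hi, hrot _ hzP i hi, hv⟩
      · rintro ⟨⟨z₁, x₁, y₁⟩, i₁⟩ - ⟨⟨z₂, x₂, y₂⟩, i₂⟩ - heq
        simp only [Prod.mk.injEq] at heq
        obtain ⟨hi, hz, hx, hy⟩ := heq
        subst hi
        have hz' : z₁ = z₂ := List.rotate_eq_rotate.1 hz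
        subst hz'
        rw [foldl_act_injective μ hμ (z₁.take i₁) hx, foldl_act_injective μ hμ (z₁.take i₁) hy]
    have hyside : Ay.card ≤ (k + 2) * Dp := by
      have hcp : (range (k + 2) ×ˢ P'.filter (fun t => t.2.2 = v)).card ≤ (k + 2) * Dp := by
        rw [card_product, card_range]; exact Nat.mul_le_mul_left _ (hDp v).2
      refine le_trans ?_ hcp
      refine card_le_card_of_injOn (fun a => (a.2, (a.1.1.rotate a.2, (a.1.1.take a.2).foldl (fun v c => μ c v) a.1.2.1,
        (a.1.1.take a.2).foldl (fun v c => μ c v) a.1.2.2))) ?_ ?_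
      · rintro ⟨⟨z, x, y⟩, i⟩ h
        rw [mem_coe, hAy, mem_filter] at h
        obtain ⟨hmem, hv⟩ := h
        simp only [mem_product, mem_range] at hmem
        obtain ⟨hzP, hi⟩ := hmem
        dsimp only at hv hi
        simp only
        rw [mem_coe, mem_product, mem_filter]
        exact ⟨mem_range.2 hi, hrot _ hzP i hi, hv⟩
      · rintro ⟨⟨z₁, x₁, y₁⟩, i₁⟩ - ⟨⟨z₂, x₂, y₂⟩, i₂⟩ - heq
        simp only [Prod.mk.injEq] at heq
        obtain ⟨hi, hz, hx, hy⟩ := heq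
        subst hi
        have hz' : z₁ = z₂ := List.rotate_eq_rotate.1 hz
        subst hz'
        rw [foldl_act_injective μ hμ (z₁.take i₁) hx, foldl_act_injective μ hμ (z₁.take i₁) hy]
    calc _ ≤ (Ax ∪ Ay).card := hcover
      _ ≤ Ax.card + Ay.card := card_union_le _ _
      _ ≤ (k + 2) * Dp + (k + 2) * Dp := Nat.add_le_add hxside hyside
      _ = 2 * (k + 2) * Dp := by ring
  · -- count
    rw [card_image_of_injOn hTinj]
    exact hGoodCard

end TwinsEll2

end Summit.MatrixMultiplication.MatrixMultiplication.Theorems.HyperoctahedralThreshold
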